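import Summits.BirchSwinnertonDyer.BirchSwinnertonDyer.Theorems.TwoAdicConverseLambdaHalfDefs
import Summits.BirchSwinnertonDyer.Rank1Residual.F1Sign2.AnalyticLineTransferAtTwo
import Literature.NumberTheory.EllipticCurves.PAdicLFunctionMinus
import HarnessLib

/-!
# Sketch (crux-ideate, ideator 2, GEN 5) — idea `plus-minus-vector-two` for crux `OrdLambdaHalfAtTwo`
# (item stmt-BirchSwinnertonDyer-19556, route TwoAdicConverse, rung S3). BSD is NOT proved here.

Habitat: the REAL-CUBIC locus `𝔖⁺ = {Δ_E > 0, Δ_E ∉ ℚ², no rational 2-torsion}` (mod-2 image `S₃`, all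
three 2-torsion points real; complex conjugation acts TRIVIALLY on `E[2] = H₁(E(ℂ), 𝔽₂)`), the one stratum
with no line after round 1 (538 / 2331 good-ordinary classes `N < 10⁴`).

The idea in one line: on `𝔖⁺` the `μ`-stripped mod-2 PLUS and MINUS 2-adic `L`-functions of `f_E` are the
two coordinates of ONE `E[2]`-valued power series `𝓛_E ∈ E[2] ⊗ 𝔽₂⟦T⟧` (the mod-2 modular symbol pushed to
`H₁(E, 𝔽₂)`; structurally: `ℤ₂⟦ℤ₂ˣ⟧ = Λ[C₂]` does not split into `±` parts at `2`, and `c ≡ 1` on `E[2]`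
iff `Δ > 0`).  The three non-zero functionals of `E[2]` (Weil-duals of `T_min, T_max, T_mid`) read off
`L̄⁺`, `L̄⁻`, `L̄⁺ + L̄⁻`; over the DVR `𝔽₂⟦T⟧` their `T`-orders are ISOSCELES with the odd one out STRICTLY
larger (§1, proved), which is the observed archimedean class law (EVIDENCE-decorated-classlaw-g4: 21/21
"two equal, third larger", 199/199 even gaps).  §2–§3 TYPE the refutable laws this predicts, over tree
declarations only (`AlignedAtTwo`, `AlignedAtInfinity`, `twoDivisionUCubic`, `lambdaCorrectionAtTwo`,
`padicLFunction`, `padicLFunctionMinusBranch`, `MuLambda.lam`, `SelmerDualData`).  Nothing in §2–§3 is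
asserted: every law is a `Prop` (hypothesis shape for a later line).
-/

set_option linter.dupNamespace false
set_option autoImplicit false

noncomputable section

open scoped Classical MatrixGroups ModularForm
open CongruenceSubgroup Polynomial WeierstrassCurve
open Literature.NumberTheory.EllipticCurves Literature.NumberTheory.EllipticCurves.ModularForms
open Literature.NumberTheory.EllipticCurves.Greenberg1999
open Literature.NumberTheory.EllipticCurves.Rank1Residual
open Summit.BirchSwinnertonDyer.Rank1Residual.X1.MuLambda
open Summit.BirchSwinnertonDyer.Rank1Residual.F1Sign2
open Summit.BirchSwinnertonDyer.BirchSwinnertonDyer.Theorems.TwoAdicTwistConverse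
open IsDedekindDomain NumberField

namespace Summit.BirchSwinnertonDyer.BirchSwinnertonDyer.Cruxes.OrdLambdaHalfAtTwo.PlusMinusVectorTwo

/-! ## §1  The `𝔽₂`-isosceles lemma (PROVED): the algebraic core of the archimedean class law

For two non-zero power series `f, g` over `𝔽₂` — think `f = L̄⁺ = φ_min(𝓛)`, `g = L̄⁻ = φ_max(𝓛)`, so that
`f + g = φ_mid(𝓛)` — the three `T`-orders `{ord f, ord g, ord (f+g)}` always have the shape `{a, a, b}`
with `b > a` STRICTLY: if `ord f ≠ ord g` the sum has the smaller order (ultrametric, any ring), and if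
`ord f = ord g = a` the two leading coefficients are both `1 ∈ 𝔽₂` and CANCEL, so `ord (f+g) > a`.
This is "3 archimedean types, two `λ` equal, the third larger, never all three equal". -/

theorem zmod2_eq_one_of_ne_zero (x : ZMod 2) (hx : x ≠ 0) : x = 1 := by
  revert x; decide

/-- Strict jump of the order of a sum of two `𝔽₂`-power series of EQUAL order. [folklore] -/
theorem order_lt_order_add_of_order_eq (f g : PowerSeries (ZMod 2)) (hf : f ≠ 0)
    (h : f.order = g.order) : f.order < (f + g).order := by
  have hg : g ≠ 0 := by
    intro hg0
    apply hf
    rw [← PowerSeries.order_eq_top] at hg0 ⊢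
    rw [h]; exact hg0
  set n := f.order.toNat with hn_def
  have hfn : f.order = n := (PowerSeries.coe_toNat_order hf).symm
  have hgn : g.order = n := by rw [← h, hfn]
  have hcf : PowerSeries.coeff n f = 1 := by
    apply zmod2_eq_one_of_ne_zero
    exact PowerSeries.coeff_order hf
  have hcg : PowerSeries.coeff n g = 1 := by
    apply zmod2_eq_one_of_ne_zero
    have hgt : g.order.toNat = n := by rw [← h]
    have := PowerSeries.coeff_order hg
    rw [hgt] at this
    exact this
  have hle : ((n + 1 : ℕ) : ℕ∞) ≤ (f + g).order := by
    apply PowerSeries.nat_le_order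
    intro i hi
    rcases Nat.lt_succ_iff_lt_or_eq.1 hi with hlt | heq
    · have h1 : PowerSeries.coeff i f = 0 :=
        PowerSeries.coeff_of_lt_order i (by rw [hfn]; exact_mod_cast hlt)
      have h2 : PowerSeries.coeff i g = 0 :=
        PowerSeries.coeff_of_lt_order i (by rw [hgn]; exact_mod_cast hlt)
      rw [map_add, h1, h2, add_zero]
    · subst heq
      rw [map_add, hcf, hcg]; decide
  rw [hfn]
  exact lt_of_lt_of_le (by exact_mod_cast Nat.lt_succ_self n) hle

/-- **The `𝔽₂`-isosceles law.** For non-zero `f, g ∈ 𝔽₂⟦T⟧` exactly one of the three "types" `f`, `g`,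
`f + g` has strictly larger order and the other two orders agree. [folklore] -/
theorem isosceles_order (f g : PowerSeries (ZMod 2)) (hf : f ≠ 0) (_hg : g ≠ 0) :
    (f.order = g.order ∧ f.order < (f + g).order) ∨
    (f.order = (f + g).order ∧ f.order < g.order) ∨
    (g.order = (f + g).order ∧ g.order < f.order) := by
  rcases eq_or_ne f.order g.order with h | h
  · exact Or.inl ⟨h, order_lt_order_add_of_order_eq f g hf h⟩
  · have hadd := PowerSeries.order_add_of_order_ne f g h
    rcases lt_or_gt_of_ne h with hlt | hgt
    · refine Or.inr (Or.inl ⟨?_, hlt⟩)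
      rw [hadd, inf_eq_left.2 hlt.le]
    · refine Or.inr (Or.inr ⟨?_, hgt⟩)
      rw [hadd, inf_eq_right.2 hgt.le]

/-! ## §2  The habitat and the archimedean types -/

/-- The REAL-CUBIC locus `𝔖⁺` at `2`: `Δ > 0` (three real 2-torsion points; complex conjugation acts
trivially on `E[2]`), `Δ` not a rational square and no rational `2`-torsion (so `ρ̄_{E,2}(G_ℚ) = S₃` and the
`2`-division cubic field `K = ℚ(e)` is a TOTALLY REAL non-Galois cubic field). A predicate; nothing asserted. -/
def OnRealCubicLocusAtTwo (W : WeierstrassCurve ℚ) : Prop :=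
  0 < W.Δ ∧ ¬ IsSquare W.Δ ∧ ∀ x : ℚ, ¬ HasRationalTwoTorsionX W x

/-- MIN–MAX ANTI-ALIGNMENT at `∞` of two root choices `e₁, e₂ ∈ F` of the cubics `c₁, c₂`: under every
real embedding `σ` of `F`, `σ e₁` is the SMALLEST real root of `c₁` iff `σ e₂` is the LARGEST real root of
`c₂` (the non-identity-component point `T_min` of the first curve corresponds to the identity-component
point `T_max = E(ℝ)⁰[2]` of the second).  This is the archimedean type carried by an IMAGINARY quadratic
twist inside a `Δ > 0` congruence class (data: `79a1 ↔ 711c1 = 79a1 ⊗ χ₋₃`).  A predicate. [folklore] -/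
def AntiAlignedAtInfinity (F : Type) [Field F] (c₁ c₂ : ℚ[X]) (e₁ e₂ : F) : Prop :=
  ∀ σ : F →+* ℝ,
    ((∀ x : ℝ, aeval x c₁ = 0 → σ e₁ ≤ x) ↔ (∀ x : ℝ, aeval x c₂ = 0 → x ≤ σ e₂))

/-! ## §3  The predicted laws (hypothesis shapes; NOT asserted, NOT in print at `p = 2`)

Conventions as in the crux: `L₀` ranges over the non-zero INTEGRAL rational multiples of the `2`-adic
`L`-function (`iwasawaToPowerSeries 2 L₀ = C c · L₂(f, α)`), `lam` is its `λ`-invariant (insensitive to `c`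
and to `μ`), and `Σ e_ℓ` is the Greenberg–Vatsal/Matsuno local correction over the odd primes of the product
of the conductors (`lambdaCorrectionAtTwo`; the same for the minus branch, since `ω ≡ 1 (mod 2)`). -/

/-- **(V-iso) the archimedean isosceles law (analytic, refutable).** Three curves on `𝔖⁺`, good ordinary at
`2`, whose `2`-division cubics have roots `e₁, e₂, e₃` in ONE cubic field `F`, pairwise ALIGNED AT `2`
(same dyadic decoration) and pairwise MIS-aligned at `∞` (the three archimedean types), have corrected
analytic `λ`-invariants of the shape `{a, a, b}` with `b > a`, all pairwise differences EVEN.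
Prediction of the vector model (`Λᵢ + const = ord φᵢ(𝓛)` for the three non-zero functionals `φᵢ` of
`E[2]`, §1) — observed 21/21 and 199/199 (EVIDENCE-decorated-classlaw-g4).  Nothing asserted. -/
def RealTypeIsoscelesLawAtTwo : Prop :=
  ∀ (W₁ : WeierstrassCurve ℚ) [W₁.IsElliptic] [W₁.IsGloballyMinimal]
    (W₂ : WeierstrassCurve ℚ) [W₂.IsElliptic] [W₂.IsGloballyMinimal]
    (W₃ : WeierstrassCurve ℚ) [W₃.IsElliptic] [W₃.IsGloballyMinimal],
    OnRealCubicLocusAtTwo W₁ → OnRealCubicLocusAtTwo W₂ → OnRealCubicLocusAtTwo W₃ →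
    GoodOrd W₁ 2 → GoodOrd W₂ 2 → GoodOrd W₃ 2 →
    IsOrdinaryAt W₁ 2 → IsOrdinaryAt W₂ 2 → IsOrdinaryAt W₃ 2 →
    ∀ (F : Type) [Field F] [NumberField F], Module.finrank ℚ F = 3 →
    ∀ e₁ e₂ e₃ : F, aeval e₁ (twoDivisionUCubic W₁) = 0 → aeval e₂ (twoDivisionUCubic W₂) = 0 →
      aeval e₃ (twoDivisionUCubic W₃) = 0 →
    AlignedAtTwo F e₁ e₂ → AlignedAtTwo F e₁ e₃ → AlignedAtTwo F e₂ e₃ →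
    ¬ AlignedAtInfinity F (twoDivisionUCubic W₁) (twoDivisionUCubic W₂) e₁ e₂ →
    ¬ AlignedAtInfinity F (twoDivisionUCubic W₁) (twoDivisionUCubic W₃) e₁ e₃ →
    ¬ AlignedAtInfinity F (twoDivisionUCubic W₂) (twoDivisionUCubic W₃) e₂ e₃ →
    ∀ [NeZero (W₁.conductorNorm ℤ)] (f₁ : CuspForm (Gamma0 (W₁.conductorNorm ℤ)) 2), IsNewformOf W₁ f₁ →
    ∀ [NeZero (W₂.conductorNorm ℤ)] (f₂ : CuspForm (Gamma0 (W₂.conductorNorm ℤ)) 2), IsNewformOf W₂ f₂ →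
    ∀ [NeZero (W₃.conductorNorm ℤ)] (f₃ : CuspForm (Gamma0 (W₃.conductorNorm ℤ)) 2), IsNewformOf W₃ f₃ →
    ∀ (c₁ c₂ c₃ : ℚ) (L₁ L₂ L₃ : IwasawaAlgebra 2), L₁ ≠ 0 → L₂ ≠ 0 → L₃ ≠ 0 →
      iwasawaToPowerSeries 2 L₁ = PowerSeries.C (c₁ : ℚ_[2]) * padicLFunction f₁ (unitRoot W₁ 2 : ℚ_[2]) →
      iwasawaToPowerSeries 2 L₂ = PowerSeries.C (c₂ : ℚ_[2]) * padicLFunction f₂ (unitRoot W₂ 2 : ℚ_[2]) →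
      iwasawaToPowerSeries 2 L₃ = PowerSeries.C (c₃ : ℚ_[2]) * padicLFunction f₃ (unitRoot W₃ 2 : ℚ_[2]) →
      let S := ((W₁.conductorNorm ℤ) * (W₂.conductorNorm ℤ) * (W₃.conductorNorm ℤ)).primeFactors.erase 2
      let Λ₁ := lam L₁ + ∑ ℓ ∈ S, lambdaCorrectionAtTwo W₁ ℓ
      let Λ₂ := lam L₂ + ∑ ℓ ∈ S, lambdaCorrectionAtTwo W₂ ℓ
      let Λ₃ := lam L₃ + ∑ ℓ ∈ S, lambdaCorrectionAtTwo W₃ ℓ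
      ((Λ₁ = Λ₂ ∧ Λ₁ < Λ₃) ∨ (Λ₁ = Λ₃ ∧ Λ₁ < Λ₂) ∨ (Λ₂ = Λ₃ ∧ Λ₂ < Λ₁)) ∧
        Even (Λ₁ + Λ₂) ∧ Even (Λ₁ + Λ₃)

/-- **(V-minus) the minus coordinate law (analytic, refutable).** For `W` on `𝔖⁺` and a congruent partner
`W'` aligned with `W` at `2` but MIN–MAX ANTI-ALIGNED at `∞`, the corrected `λ` of the PLUS `2`-adic
`L`-function of `W'` equals the corrected `λ` of the MINUS (odd, `ω`-) branch of the `2`-adic `L`-function of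
`W` (`padicLFunctionMinusBranch f α 1`, MTT §I.13): the partner reads the coordinate `φ_max(𝓛_E)`.
Special case in print modulo assembly: `W' = W ⊗ χ_d`, `d < 0` (MTT twisting + `χ_d ≡ 1 (mod 2)`); the
general congruent case is the vector model's prediction.  Nothing asserted. -/
def MinusCoordinateLawAtTwo : Prop :=
  ∀ (W : WeierstrassCurve ℚ) [W.IsElliptic] [W.IsGloballyMinimal]
    (W' : WeierstrassCurve ℚ) [W'.IsElliptic] [W'.IsGloballyMinimal],
    OnRealCubicLocusAtTwo W → OnRealCubicLocusAtTwo W' →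
    GoodOrd W 2 → GoodOrd W' 2 → IsOrdinaryAt W 2 → IsOrdinaryAt W' 2 →
    ∀ (F : Type) [Field F] [NumberField F], Module.finrank ℚ F = 3 →
    ∀ e e' : F, aeval e (twoDivisionUCubic W) = 0 → aeval e' (twoDivisionUCubic W') = 0 →
    AlignedAtTwo F e e' →
    AntiAlignedAtInfinity F (twoDivisionUCubic W') (twoDivisionUCubic W) e' e →
    ∀ [NeZero (W.conductorNorm ℤ)] (f : CuspForm (Gamma0 (W.conductorNorm ℤ)) 2), IsNewformOf W f →
    ∀ [NeZero (W'.conductorNorm ℤ)] (f' : CuspForm (Gamma0 (W'.conductorNorm ℤ)) 2), IsNewformOf W' f' →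
    ∀ (c c' : ℚ) (Lm L' : IwasawaAlgebra 2), Lm ≠ 0 → L' ≠ 0 →
      iwasawaToPowerSeries 2 Lm =
        PowerSeries.C (c : ℚ_[2]) * padicLFunctionMinusBranch f (unitRoot W 2 : ℚ_[2]) 1 →
      iwasawaToPowerSeries 2 L' = PowerSeries.C (c' : ℚ_[2]) * padicLFunction f' (unitRoot W' 2 : ℚ_[2]) →
      let S := ((W.conductorNorm ℤ) * (W'.conductorNorm ℤ)).primeFactors.erase 2
      lam L' + ∑ ℓ ∈ S, lambdaCorrectionAtTwo W' ℓ = lam Lm + ∑ ℓ ∈ S, lambdaCorrectionAtTwo W ℓ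

/-- **(V-alg) the algebraic isosceles law (the PROVABLE twin; first honest rung for a prover).** Same
hypotheses as (V-iso), conclusion on the algebraic side: the corrected `λ(X(Wᵢ/ℚ_∞))` are isosceles-strict
with even gaps.  Mechanism (informal, Galois cohomology only): with `Ω = 𝔽₂⟦T⟧`, the dual `N` of the
relaxed-at-`∞` residual Selmer group of the common `E[2]` along `ℚ_∞` has `Ω`-rank one; the three
structures are the kernels of the three non-zero functionals of `E[2] = H¹(ℝ, E[2])` composed with the
archimedean row `(ℓ₁, ℓ₂) ∈ Ω²` of `N`, so `λ_t = ord(φ_t(ℓ)) + (torsion, type-independent)` and §1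
applies; needs `μ = 0` (price P-μ).  Nothing asserted. -/
def RealTypeIsoscelesAlgAtTwo : Prop :=
  ∀ (W₁ : WeierstrassCurve ℚ) [W₁.IsElliptic] [W₁.IsGloballyMinimal]
    (W₂ : WeierstrassCurve ℚ) [W₂.IsElliptic] [W₂.IsGloballyMinimal]
    (W₃ : WeierstrassCurve ℚ) [W₃.IsElliptic] [W₃.IsGloballyMinimal],
    OnRealCubicLocusAtTwo W₁ → OnRealCubicLocusAtTwo W₂ → OnRealCubicLocusAtTwo W₃ →
    GoodOrd W₁ 2 → GoodOrd W₂ 2 → GoodOrd W₃ 2 →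
    IsOrdinaryAt W₁ 2 → IsOrdinaryAt W₂ 2 → IsOrdinaryAt W₃ 2 →
    ∀ (F : Type) [Field F] [NumberField F], Module.finrank ℚ F = 3 →
    ∀ e₁ e₂ e₃ : F, aeval e₁ (twoDivisionUCubic W₁) = 0 → aeval e₂ (twoDivisionUCubic W₂) = 0 →
      aeval e₃ (twoDivisionUCubic W₃) = 0 →
    AlignedAtTwo F e₁ e₂ → AlignedAtTwo F e₁ e₃ → AlignedAtTwo F e₂ e₃ →
    ¬ AlignedAtInfinity F (twoDivisionUCubic W₁) (twoDivisionUCubic W₂) e₁ e₂ →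
    ¬ AlignedAtInfinity F (twoDivisionUCubic W₁) (twoDivisionUCubic W₃) e₁ e₃ →
    ¬ AlignedAtInfinity F (twoDivisionUCubic W₂) (twoDivisionUCubic W₃) e₂ e₃ →
    ∀ (κ : ZpExtension ℚ 2) (γ : Field.absoluteGaloisGroup ℚ),
      κ.IsCyclotomic → κ.IsTopGenerator γ → IsCyclotomicVariable 2 γ →
    ∀ (D₁ : W₁.SelmerDualData κ γ) (D₂ : W₂.SelmerDualData κ γ) (D₃ : W₃.SelmerDualData κ γ),
      D₁.mu = 0 → D₂.mu = 0 → D₃.mu = 0 →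
      let S := ((W₁.conductorNorm ℤ) * (W₂.conductorNorm ℤ) * (W₃.conductorNorm ℤ)).primeFactors.erase 2
      let Λ₁ := D₁.lambda + ∑ ℓ ∈ S, lambdaCorrectionAtTwo W₁ ℓ
      let Λ₂ := D₂.lambda + ∑ ℓ ∈ S, lambdaCorrectionAtTwo W₂ ℓ
      let Λ₃ := D₃.lambda + ∑ ℓ ∈ S, lambdaCorrectionAtTwo W₃ ℓ
      ((Λ₁ = Λ₂ ∧ Λ₁ < Λ₃) ∨ (Λ₁ = Λ₃ ∧ Λ₁ < Λ₂) ∨ (Λ₂ = Λ₃ ∧ Λ₂ < Λ₁)) ∧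
        Even (Λ₁ + Λ₂) ∧ Even (Λ₁ + Λ₃)

/-- **Numerical shadow of §1 (proved): the isosceles shape is forced by an `𝔽₂`-vector reading.**  If three
natural numbers are the `T`-orders of `φ(𝓛)` for the three non-zero functionals of a two-dimensional
`𝔽₂`-space applied to one vector `𝓛 = (f, g)` with non-zero coordinates — i.e. they are `ord f`, `ord g`,
`ord (f + g)` up to a common shift `s` — then they are isosceles-strict.  This is the EXACT form in which
(V-iso)/(V-alg) follow from the vector model. -/
theorem isosceles_of_vector_reading (f g : PowerSeries (ZMod 2)) (hf : f ≠ 0) (hg : g ≠ 0)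
    (s : ℕ∞) (Λ₁ Λ₂ Λ₃ : ℕ∞)
    (h₁ : Λ₁ = f.order + s) (h₂ : Λ₂ = g.order + s) (h₃ : Λ₃ = (f + g).order + s) (hs : s ≠ ⊤) :
    (Λ₁ = Λ₂ ∧ Λ₁ < Λ₃) ∨ (Λ₁ = Λ₃ ∧ Λ₁ < Λ₂) ∨ (Λ₂ = Λ₃ ∧ Λ₂ < Λ₁) := by
  have key : ∀ a b : ℕ∞, (a + s < b + s ↔ a < b) := fun a b =>
    ENat.add_lt_add_iff_right hs
  subst h₁ h₂ h₃
  rcases isosceles_order f g hf hg with ⟨he, hl⟩ | ⟨he, hl⟩ | ⟨he, hl⟩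
  · exact Or.inl ⟨by rw [he], (key _ _).2 hl⟩
  · exact Or.inr (Or.inl ⟨by rw [he], (key _ _).2 hl⟩)
  · exact Or.inr (Or.inr ⟨by rw [he], (key _ _).2 hl⟩)

end Summit.BirchSwinnertonDyer.BirchSwinnertonDyer.Cruxes.OrdLambdaHalfAtTwo.PlusMinusVectorTwo

end
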